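import Literature.Analysis.FluidPDE.LocalPressureSliceRepresentation
import Literature.Analysis.FluidPDE.LocalPressureLiouville
import Literature.Analysis.FluidPDE.LocalLerayCubicIntegrability
import Literature.Analysis.FluidPDE.LerayPressureDecayReduction
import Literature.Analysis.FluidPDE.RieszPressureLocality
import Mathlib.MeasureTheory.Constructions.Polish.StronglyMeasurable
import HarnessLib

/-!
# Discharge of `kangMiuraTsai_pressure_decomposition` (the local pressure decomposition of local
Leray solutions; Kang–Miura–Tsai 2021, Lemma 3.4)

Analysis/FluidPDE proof file (theorems only, everything PROVED, no definitions, no named facts)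
for the named fact **PD** `Literature.Analysis.FluidPDE.kangMiuraTsai_pressure_decomposition`
(`LocalLerayPressureDecomposition.lean`; Kang–Miura–Tsai, IMRN 2021 = arXiv:1812.10509,
**Lemma 3.4** (pressure decomposition), p. 8: "Suppose `(v,π)` is a local Leray solution to (NS)
with divergence free initial data `v₀ ∈ E²` in the sense of Definition 3.2. For any `x₀ ∈ ℝ³`,
`r > 0`, and `T > 0`, we have for `(x,t) ∈ Q := B_r(x₀) × (0,T)`,
`π(x,t) = π_loc(x,t) + π_far(x,t) + c_{x₀,r}(t)` [...] for some function
`c_{x₀,r}(t) ∈ L^{3/2}(0,T)`"; proof §8, pp. 17–18). Main result: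

* `kangMiuraTsai_pressure_decomposition_holds : kangMiuraTsai_pressure_decomposition` — PROVED,

in a separate file because the fact file is imported by the slab machinery used here
(`LocalPressureOscillationSlab` → `LerayPressureDecayProofs` → `LocalLerayPressureDecomposition`).

## The proof

Kang–Miura–Tsai prove Lemma 3.4 by reconstructing a mild solution `v̄` in `L^q_uloc` with the
decomposed pressure and a Liouville argument `v = v̄` (§8). The tree realises the Liouville step
directly on the pressure, in the form of Fernández-Dalgo–Lemarié-Rieusset (DCDS-S 14 (2021),
Thm. 1): for a local Leray solution on a slab, on a.e. time slice `(w, p) = (v(t), π(t))` the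
mollified pressure gradient equals the mollified gradient of the whole-space pressure,
`∫ [p ∂ₑλ_δ(c - ·) + D³Φ_δ(c - ·)(e)(w, w)] = 0` for all `δ = 1/(n+1)`, `c`, `e`
(`IsLocalLeraySolutionOn.ae_slice_pgIdentity`, `LocalPressureLiouville.lean`). From these
identities `LocalPressureSliceRepresentation.lean` derives **Lemma 3.4 on a slice**
(`slice_pressure_representation`): `p = p̃[1_{B_{2r}(x₀)} w] + p_far + κ` a.e. on `B_r(x₀)`,
with the tree's honest near and far fields `localPressureNear`, `localPressureFar` (the
regularised near field converges a.e. to the Riesz-transform pressure `normalisedPressure` by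
Stein's a.e. convergence theorem, proved in the tree, and the Lebesgue differentiation theorem).
This file assembles the space–time statement:

* §1–§2 (measure theory of the pointwise principal value). For a finite-energy field the
  truncated singular integrals `ε ↦ ∫_{|x-y|>ε} K(x-y)(u y) dy` are all defined and continuous in
  `ε` (dominated convergence; spheres are null), so the principal value exists iff they converge
  along the *rationals* (`exists_hasPressurePV_iff_rat`); for a jointly measurable field
  `U(t, y)` the parametric truncations are jointly measurable (Fubini), hence so is the set where
  the principal value exists (`MeasureTheory.StronglyMeasurable.measurableSet_exists_tendsto`,
  countable index) and the limit (`StronglyMeasurable.limUnder`): the Riesz-transform pressure of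
  the slices has a strongly measurable modification agreeing with it at *every* point of every
  finite-energy slice (`exists_stronglyMeasurable_normalisedPressure_eq`).
* §3 `π_loc`, `π_far` of a local Leray solution are jointly a.e.-strongly measurable on
  `(0,T) × ℝ³` (modify `v` on a null set to a strongly measurable field; §2 for `π_loc`, a
  parametric integral for `π_far`).
* §4 the expansion on a.e. slice of a (global) local Leray solution (restriction to the slab,
  `IsLocalLeraySolution.isLocalLeraySolutionOn`; `v(t) ∈ L³(B_{2r}(x₀))` for a.e. `t` by Tonelli
  from `v ∈ L³` on the boxes up to `t = 0`).
* §5 the gauge `c(t) = ⨍_{B_r(x₀)} (π - π_loc - π_far)(t)` equals the slice constant for a.e. `t`,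
  is measurable (Fubini, §3) and lies in `L^{3/2}(0,T)`:
  `|c(t)|^{3/2}|B_r| ≤ 2(∫_{B_r}|π(t)|^{3/2} + C∫_{B_{2r}}|v(t)|³ + |B_r|(C_K r · tail(t))^{3/2})` by
  Calderón–Zygmund for the near field (`exists_lintegral_localPressureNear_le` with the proved
  `stein1970_normalisedPressure_ae_Lp_bound_holds`; Kang–Miura–Tsai §8 "`∫|p_loc|^q ≤ c_q∫|v|^{2q}`")
  and the kernel bound for the far field (`enorm_localPressureFar_le`, `exists_farField_tail_le`;
  "`|p_far| ≤ ∫_{2R<|y-x₀|} cR|x₀-y|⁻⁴|v|²`"), with the uniformly local energy (2) and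
  `π ∈ L^{3/2}`, `v ∈ L³` on the boxes.
* §6 the slice-wise identity is an identity a.e. on `(0,T) × B_r(x₀)` since all terms are
  jointly measurable (`Measure.ae_prod_mem_iff_ae_ae_mem` on the zero set of a strongly
  measurable modification).

The datum hypotheses of **PD** (`v₀ ∈ E²`, weakly divergence free) and `ν = 1` are not used:
as recorded in `LocalLerayPressureBound.lean`, the expansion holds for the slab class with any
datum (Bradshaw–Tsai 2022, Thm. 1.5: Jia–Šverák's decay condition implies the local pressure
expansion).

## Mathlib / tree search

Tree (`lean search 'pressure_decomposition_holds|slice_pressure_representation|hasPressurePV_iff|normalisedPressure_congr'`):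
no discharge of **PD**; the slab machinery `IsLocalLeraySolutionOn.ae_slice_pgIdentity`,
`.aestronglyMeasurable_prod`, `.ae_aestronglyMeasurable_slice'`, `.ae_locallyIntegrable_norm_sq_slice`
(`LocalPressureLiouville*`), `slice_pressure_representation` (`LocalPressureSliceRepresentation`),
`exists_lintegral_localPressureNear_le`, `enorm_localPressureFar_le`,
`IsLocalLeraySolution.exists_ae_lintegral_ball_le`, `add_rpow_threeHalves_le`,
`eLpNorm_threeHalves_lt_top_of_lintegral` (`LerayPressureDecayProofs`), `exists_farField_tail_le`,
`lintegral_lintegral_enorm_rpow_box`, `IsLocalLeraySolution.aestronglyMeasurable_pressure_box`,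
`.aestronglyMeasurable_box`, `inv_norm_pow_four_eq_rpow` (`LerayPressureDecayReduction`),
`IsLocalLeraySolution.lintegral_cube_block_lt_top` (`LocalLerayCubicIntegrability`),
`stein1970_normalisedPressure_ae_Lp_bound_holds` (`LocalLerayPressureDecompositionProofs`),
`aestronglyMeasurable_pressureKernel_sub_apply` (`RieszPressureLocality`), `abs_pressureKernel_le`,
`measurable_pressureKernel`, `exists_abs_pressureKernel_sub_le`. Mathlib:
`MeasureTheory.StronglyMeasurable.measurableSet_exists_tendsto`, `StronglyMeasurable.limUnder`,
`StronglyMeasurable.integral_prod_right'`, `Measure.ae_prod_mem_iff_ae_ae_mem`,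
`Measure.ae_ae_of_ae_prod`, `Measure.addHaar_sphere`, `continuousAt_of_dominated`,
`exists_rat_btwn`, `mem_nhdsGT_iff_exists_Ioo_subset`, `ae_lt_top'`.

## References

* K. Kang, H. Miura, T.-P. Tsai, *Short time regularity of Navier–Stokes flows with locally `L³`
  initial data and applications*, IMRN 2021 (11) 8763–8805 = arXiv:1812.10509: Lemma 3.4 (p. 8),
  §8 Appendix 1 (pp. 17–18). [`KangMiuraTsai2020`]
* P. G. Fernández-Dalgo, P. G. Lemarié-Rieusset, *Characterisation of the pressure term in the
  incompressible Navier–Stokes equations on the whole space*, DCDS-S 14 (2021) = arXiv:2001.10436,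
  Thm. 1. [`FernandezdalgoLemarierieusset2021`]
* Z. Bradshaw, T.-P. Tsai, *On the local pressure expansion for the Navier–Stokes equations*,
  J. Math. Fluid Mech. 24 (2022) = arXiv:2001.11526, Thms. 1.4–1.5. [`BradshawTsai2021`]
* E. M. Stein, *Singular integrals and differentiability properties of functions* (1970),
  Ch. II §4.5 Thm. 4. [`Stein1971`]
-/

noncomputable section

open MeasureTheory Set Filter Topology Function Metric
open scoped ENNReal NNReal RealInnerProductSpace Laplacian Convolution

namespace Literature.Analysis.FluidPDE

-- nested operator types `ℝ³ →L[ℝ] ℝ³ →L[ℝ] ℝ³ →L[ℝ] ℝ`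
set_option maxSynthPendingDepth 3

/-! ## §1. The principal value along the rationals; measurability of the Riesz-transform pressure
of the slices of a jointly measurable field -/

section PV

variable {u u' : EuclideanSpace ℝ (Fin 3) → EuclideanSpace ℝ (Fin 3)}

/-- **All truncations are integrable for a finite-energy field**: if `|u|² ∈ L¹` then
`y ↦ K(x - y)(u y)` is integrable off every closed ball about `x` (`|K(z)(a)| ≤ |a|²/(2π|z|³)`).
[folklore] -/
theorem integrableOn_pressureKernel_compl_closedBall_of_integrable
    (hu : AEStronglyMeasurable u volume) (hu2 : Integrable (fun y => ‖u y‖ ^ 2) volume)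
    (x : EuclideanSpace ℝ (Fin 3)) {ε : ℝ} (hε : 0 < ε) :
    IntegrableOn (fun y => pressureKernel (x - y) (u y)) (closedBall x ε)ᶜ volume := by
  refine Integrable.mono' ((hu2.integrableOn).mul_const ((2 * Real.pi * ε ^ 3)⁻¹))
    (aestronglyMeasurable_pressureKernel_sub_apply hu x).restrict ?_
  refine (ae_restrict_iff' measurableSet_closedBall.compl).2 (Eventually.of_forall fun y hy => ?_)
  have hy' : ε < ‖x - y‖ := by
    rw [mem_compl_iff, mem_closedBall, not_le, dist_eq_norm, ← norm_neg, neg_sub] at hy; exact hy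
  have hpos : 0 < ‖x - y‖ := hε.trans hy'
  rw [Real.norm_eq_abs]
  calc |pressureKernel (x - y) (u y)| ≤ ‖u y‖ ^ 2 / (2 * Real.pi * ‖x - y‖ ^ 3) :=
        abs_pressureKernel_le _ _
    _ ≤ ‖u y‖ ^ 2 * (2 * Real.pi * ε ^ 3)⁻¹ := by
        rw [div_eq_mul_inv]
        gcongr

/-- **Continuity of the truncated singular integral in the truncation radius**: for a
finite-energy field `u` and `ε₀ > 0`, `ε ↦ ∫_{|x-y|>ε} K(x-y)(u y) dy` is continuous at `ε₀`
(dominated convergence; the sphere `|x - y| = ε₀` is null). [folklore] -/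
theorem continuousAt_truncatedPressureIntegral (hu : AEStronglyMeasurable u volume)
    (hu2 : Integrable (fun y => ‖u y‖ ^ 2) volume) (x : EuclideanSpace ℝ (Fin 3)) {ε₀ : ℝ}
    (hε₀ : 0 < ε₀) : ContinuousAt (truncatedPressureIntegral u x) ε₀ := by
  set k : EuclideanSpace ℝ (Fin 3) → ℝ := fun y => pressureKernel (x - y) (u y) with hk
  set F : ℝ → EuclideanSpace ℝ (Fin 3) → ℝ := fun ε y => ((closedBall x ε)ᶜ).indicator k y with hF
  have hrepr : truncatedPressureIntegral u x = fun ε => ∫ y, F ε y := by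
    funext ε
    rw [truncatedPressureIntegral, hF]
    exact (integral_indicator measurableSet_closedBall.compl).symm
  rw [hrepr]
  have hkm : AEStronglyMeasurable k volume := aestronglyMeasurable_pressureKernel_sub_apply hu x
  set bound : EuclideanSpace ℝ (Fin 3) → ℝ := fun y =>
    ((closedBall x (ε₀ / 2))ᶜ).indicator (fun y => ‖k y‖) y with hbound
  refine continuousAt_of_dominated (bound := bound) ?_ ?_ ?_ ?_
  · exact Eventually.of_forall fun ε => hkm.indicator measurableSet_closedBall.compl
  · have hev : ∀ᶠ ε in 𝓝 ε₀, ε₀ / 2 < ε := Ioi_mem_nhds (by linarith)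
    filter_upwards [hev] with ε hε
    refine Eventually.of_forall fun y => ?_
    rw [hF, hbound]
    dsimp only
    by_cases hy : y ∈ (closedBall x ε)ᶜ
    · have hy2 : y ∈ (closedBall x (ε₀ / 2))ᶜ := by
        rw [mem_compl_iff, mem_closedBall, not_le] at hy ⊢
        linarith
      rw [indicator_of_mem hy, indicator_of_mem hy2]
    · rw [indicator_of_notMem hy, norm_zero]
      exact indicator_nonneg (fun _ _ => norm_nonneg _) _
  · rw [hbound]
    exact IntegrableOn.integrable_indicator
      ((integrableOn_pressureKernel_compl_closedBall_of_integrable hu hu2 x (half_pos hε₀)).norm)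
      measurableSet_closedBall.compl
  · have hsphere : ∀ᵐ y ∂(volume : Measure (EuclideanSpace ℝ (Fin 3))), y ∉ sphere x ε₀ :=
      measure_eq_zero_iff_ae_notMem.1 (Measure.addHaar_sphere volume x ε₀)
    filter_upwards [hsphere] with y hy
    rw [mem_sphere] at hy
    rcases lt_or_gt_of_ne hy with hlt | hgt
    · -- `dist y x < ε₀`: the integrand vanishes for `ε` near `ε₀`
      have hev : ∀ᶠ ε in 𝓝 ε₀, dist y x < ε := Ioi_mem_nhds hlt
      refine Filter.EventuallyEq.continuousAt (y := (0 : ℝ)) ?_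
      filter_upwards [hev] with ε hε
      rw [hF]
      dsimp only
      rw [indicator_of_notMem]
      rw [mem_compl_iff, mem_closedBall, not_le, not_lt]
      exact hε.le
    · -- `ε₀ < dist y x`: the integrand is `k y` for `ε` near `ε₀`
      have hev : ∀ᶠ ε in 𝓝 ε₀, ε < dist y x := Iio_mem_nhds hgt
      refine Filter.EventuallyEq.continuousAt (y := k y) ?_
      filter_upwards [hev] with ε hε
      rw [hF]
      dsimp only
      rw [indicator_of_mem]
      rw [mem_compl_iff, mem_closedBall, not_le]
      exact hε

/-- The filter of positive rationals tending to `0⁺` (pulled back from `𝓝[>] 0` on `ℝ`); it is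
countably generated and non-trivial. [folklore] -/
theorem neBot_comap_ratCast_nhdsGT_zero :
    (comap (fun q : ℚ => (q : ℝ)) (𝓝[>] (0 : ℝ))).NeBot := by
  refine comap_neBot fun s hs => ?_
  obtain ⟨b, hb, hbs⟩ := mem_nhdsGT_iff_exists_Ioo_subset.1 hs
  obtain ⟨q, hq0, hqb⟩ := exists_rat_btwn (show (0 : ℝ) < b from hb)
  exact ⟨q, hbs ⟨hq0, hqb⟩⟩

/-- **Limits at `0⁺` of a function continuous on `(0, ∞)` are detected along the rationals.**
[folklore] -/
theorem exists_tendsto_nhdsGT_iff_rat {f : ℝ → ℝ} (hf : ∀ ε : ℝ, 0 < ε → ContinuousAt f ε) :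
    (∃ L, Tendsto f (𝓝[>] 0) (𝓝 L)) ↔
      ∃ L, Tendsto (fun q : ℚ => f q) (comap (fun q : ℚ => (q : ℝ)) (𝓝[>] (0 : ℝ))) (𝓝 L) := by
  constructor
  · rintro ⟨L, hL⟩
    exact ⟨L, hL.comp tendsto_comap⟩
  · rintro ⟨L, hL⟩
    refine ⟨L, Metric.tendsto_nhds.2 fun η hη => ?_⟩
    have h1 : ∀ᶠ q : ℚ in comap (fun q : ℚ => (q : ℝ)) (𝓝[>] (0 : ℝ)), dist (f q) L < η / 2 :=
      Metric.tendsto_nhds.1 hL (η / 2) (half_pos hη)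
    rw [eventually_comap] at h1
    obtain ⟨b, hb, hbs⟩ := mem_nhdsGT_iff_exists_Ioo_subset.1 h1
    filter_upwards [Ioo_mem_nhdsGT (show (0 : ℝ) < b from hb)] with ε hε
    -- a rational close to `ε` inside `(0, b)`
    have hV : ∀ᶠ s in 𝓝 ε, dist (f s) (f ε) < η / 2 ∧ s ∈ Ioo (0 : ℝ) b :=
      ((Metric.tendsto_nhds.1 (hf ε hε.1) (η / 2) (half_pos hη))).and (Ioo_mem_nhds hε.1 hε.2)
    obtain ⟨ρ, hρ, hρV⟩ := Metric.mem_nhds_iff.1 hV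
    obtain ⟨q, hq1, hq2⟩ := exists_rat_btwn (show ε < ε + ρ by linarith)
    have hqball : (q : ℝ) ∈ ball ε ρ := by
      rw [mem_ball, Real.dist_eq, abs_of_pos (by linarith)]
      linarith
    obtain ⟨hq3, hq4⟩ := hρV hqball
    have hq5 : dist (f q) L < η / 2 := hbs hq4 q rfl
    calc dist (f ε) L ≤ dist (f ε) (f q) + dist (f q) L := dist_triangle _ _ _
      _ < η / 2 + η / 2 := by rw [dist_comm]; exact add_lt_add hq3 hq5
      _ = η := by ring

/-- **The principal value exists iff the truncated integrals converge along the rationals**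
(finite-energy fields: all truncations are integrable and the truncated integral is continuous
in the radius). [folklore] -/
theorem exists_hasPressurePV_iff_rat (hu : AEStronglyMeasurable u volume)
    (hu2 : Integrable (fun y => ‖u y‖ ^ 2) volume) (x : EuclideanSpace ℝ (Fin 3)) :
    (∃ L, HasPressurePV u x L) ↔
      ∃ L, Tendsto (fun q : ℚ => truncatedPressureIntegral u x q)
        (comap (fun q : ℚ => (q : ℝ)) (𝓝[>] (0 : ℝ))) (𝓝 L) := by
  rw [← exists_tendsto_nhdsGT_iff_rat (fun ε hε => continuousAt_truncatedPressureIntegral hu hu2 x hε)]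
  constructor
  · rintro ⟨L, -, hL⟩
    exact ⟨L, hL⟩
  · rintro ⟨L, hL⟩
    refine ⟨L, ?_, hL⟩
    filter_upwards [self_mem_nhdsWithin] with ε hε
    exact integrableOn_pressureKernel_compl_closedBall_of_integrable hu hu2 x hε

/-- **The principal value does not see null modifications of the field.** [folklore] -/
theorem hasPressurePV_congr_ae (h : u =ᵐ[volume] u') (x : EuclideanSpace ℝ (Fin 3)) (L : ℝ) :
    HasPressurePV u x L ↔ HasPressurePV u' x L := by
  have hk : (fun y => pressureKernel (x - y) (u y)) =ᵐ[volume] fun y => pressureKernel (x - y) (u' y) := by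
    filter_upwards [h] with y hy
    rw [hy]
  have hT : truncatedPressureIntegral u x = truncatedPressureIntegral u' x := by
    funext ε
    exact integral_congr_ae (ae_restrict_of_ae hk)
  have hI : ∀ ε, IntegrableOn (fun y => pressureKernel (x - y) (u y)) (closedBall x ε)ᶜ volume ↔
      IntegrableOn (fun y => pressureKernel (x - y) (u' y)) (closedBall x ε)ᶜ volume := fun ε =>
    integrableOn_congr_fun_ae (ae_restrict_of_ae hk)
  simp only [HasPressurePV, hT, hI]

/-- **The Riesz-transform pressure does not see null modifications of the field away from the
evaluation point**: if `u = u'` a.e. and `u x = u' x` then `p̃[u](x) = p̃[u'](x)`. [folklore] -/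
theorem normalisedPressure_congr_ae (h : u =ᵐ[volume] u') {x : EuclideanSpace ℝ (Fin 3)}
    (hx : u x = u' x) : normalisedPressure u x = normalisedPressure u' x := by
  by_cases hex : ∃ L, HasPressurePV u x L
  · obtain ⟨L, hL⟩ := hex
    rw [normalisedPressure_eq hL, normalisedPressure_eq ((hasPressurePV_congr_ae h x L).1 hL), hx]
  · have hex' : ¬ ∃ L, HasPressurePV u' x L := fun ⟨L, hL⟩ =>
      hex ⟨L, (hasPressurePV_congr_ae h x L).2 hL⟩
    rw [normalisedPressure_eq_zero_of_not_exists hex, normalisedPressure_eq_zero_of_not_exists hex']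

end PV

/-! ## §2. A strongly measurable modification of the Riesz-transform pressure of the slices of a
jointly measurable field -/

section SliceMeasurability

variable {U : ℝ → EuclideanSpace ℝ (Fin 3) → EuclideanSpace ℝ (Fin 3)}

/-- **Joint measurability of the parametric truncated singular integrals**
`(t, x) ↦ ∫_{|x-y|>ε} K(x - y)(U t y) dy` for a jointly measurable field `U`
(a parametric integral of a measurable integrand). [folklore] -/
theorem stronglyMeasurable_truncatedPressureIntegral_uncurry (hU : StronglyMeasurable (uncurry U))
    (ε : ℝ) :
    StronglyMeasurable fun z : ℝ × EuclideanSpace ℝ (Fin 3) =>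
      truncatedPressureIntegral (U z.1) z.2 ε := by
  -- the integrand `((t,x),y) ↦ 1_{ε < |x-y|} K(x-y)(U t y)` is jointly measurable
  have hD : MeasurableSet {q : (ℝ × EuclideanSpace ℝ (Fin 3)) × EuclideanSpace ℝ (Fin 3) |
      ε < dist q.2 q.1.2} :=
    measurableSet_lt measurable_const (measurable_snd.dist (measurable_snd.comp measurable_fst))
  have hpair : Measurable fun q : (ℝ × EuclideanSpace ℝ (Fin 3)) × EuclideanSpace ℝ (Fin 3) =>
      (q.1.2 - q.2, uncurry U (q.1.1, q.2)) :=
    ((measurable_snd.comp measurable_fst).sub measurable_snd).prodMk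
      (hU.measurable.comp ((measurable_fst.comp measurable_fst).prodMk measurable_snd))
  -- (the composition is elaborated on its own: unifying it against a `fun`-stated goal is slow)
  have hK : Measurable ((fun p : EuclideanSpace ℝ (Fin 3) × EuclideanSpace ℝ (Fin 3) =>
      pressureKernel p.1 p.2) ∘ fun q : (ℝ × EuclideanSpace ℝ (Fin 3)) × EuclideanSpace ℝ (Fin 3) =>
        (q.1.2 - q.2, uncurry U (q.1.1, q.2))) :=
    measurable_pressureKernel.comp hpair
  set F : (ℝ × EuclideanSpace ℝ (Fin 3)) × EuclideanSpace ℝ (Fin 3) → ℝ :=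
    {q : (ℝ × EuclideanSpace ℝ (Fin 3)) × EuclideanSpace ℝ (Fin 3) | ε < dist q.2 q.1.2}.indicator
      ((fun p : EuclideanSpace ℝ (Fin 3) × EuclideanSpace ℝ (Fin 3) => pressureKernel p.1 p.2) ∘
        fun q : (ℝ × EuclideanSpace ℝ (Fin 3)) × EuclideanSpace ℝ (Fin 3) =>
          (q.1.2 - q.2, uncurry U (q.1.1, q.2))) with hF
  have hFm : Measurable F := hK.indicator hD
  have h1 : StronglyMeasurable fun z : ℝ × EuclideanSpace ℝ (Fin 3) => ∫ y, F (z, y) :=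
    hFm.stronglyMeasurable.integral_prod_right'
  have heq : (fun z : ℝ × EuclideanSpace ℝ (Fin 3) => truncatedPressureIntegral (U z.1) z.2 ε) =
      fun z => ∫ y, F (z, y) := by
    funext z
    rw [truncatedPressureIntegral, ← integral_indicator measurableSet_closedBall.compl]
    congr 1
    funext y
    by_cases hy : ε < dist y z.2
    · have hy1 : y ∈ (closedBall z.2 ε)ᶜ := by
        rw [mem_compl_iff, mem_closedBall, not_le]; exact hy
      have hy2 : (z, y) ∈ {q : (ℝ × EuclideanSpace ℝ (Fin 3)) × EuclideanSpace ℝ (Fin 3) |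
          ε < dist q.2 q.1.2} := hy
      rw [indicator_of_mem hy1, hF, indicator_of_mem hy2]
      rfl
    · have hy1 : y ∉ (closedBall z.2 ε)ᶜ := by
        rw [mem_compl_iff, mem_closedBall, not_le]; exact hy
      have hy2 : (z, y) ∉ {q : (ℝ × EuclideanSpace ℝ (Fin 3)) × EuclideanSpace ℝ (Fin 3) |
          ε < dist q.2 q.1.2} := hy
      rw [indicator_of_notMem hy1, hF, indicator_of_notMem hy2]
  rw [heq]
  exact h1

/-- **A strongly measurable modification of the Riesz-transform pressure of the slices.** For a
jointly measurable field `U : ℝ × ℝ³ → ℝ³` there is a strongly measurable `g : ℝ × ℝ³ → ℝ` with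
`p̃[U(t)](x) = g(t, x)` for *every* `x` and every `t` at which `|U(t)|² ∈ L¹` (at such `t` the
principal value exists iff the truncated integrals converge along the rationals,
`exists_hasPressurePV_iff_rat`; the set of convergence of countably many jointly measurable
functions along a countably generated filter is measurable, `measurableSet_exists_tendsto`, and
the limit is measurable, `StronglyMeasurable.limUnder`). [folklore] -/
theorem exists_stronglyMeasurable_normalisedPressure_eq (hU : StronglyMeasurable (uncurry U))
    {G : Set ℝ} (hint : ∀ t ∈ G, Integrable (fun y => ‖U t y‖ ^ 2) volume) :
    ∃ g : ℝ × EuclideanSpace ℝ (Fin 3) → ℝ, StronglyMeasurable g ∧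
      ∀ t ∈ G, ∀ x, normalisedPressure (U t) x = g (t, x) := by
  set l : Filter ℚ := comap (fun q : ℚ => (q : ℝ)) (𝓝[>] (0 : ℝ)) with hl
  haveI : l.NeBot := neBot_comap_ratCast_nhdsGT_zero
  set Tq : ℚ → ℝ × EuclideanSpace ℝ (Fin 3) → ℝ := fun q z =>
    truncatedPressureIntegral (U z.1) z.2 q with hTq
  have hTqm : ∀ q, StronglyMeasurable (Tq q) := fun q =>
    stronglyMeasurable_truncatedPressureIntegral_uncurry hU q
  set Ev : Set (ℝ × EuclideanSpace ℝ (Fin 3)) := {z | ∃ c, Tendsto (fun q => Tq q z) l (𝓝 c)} with hEv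
  have hEvm : MeasurableSet Ev := MeasureTheory.StronglyMeasurable.measurableSet_exists_tendsto hTqm
  set g : ℝ × EuclideanSpace ℝ (Fin 3) → ℝ := fun z =>
    Ev.indicator (fun z => -‖U z.1 z.2‖ ^ 2 / 3 + limUnder l (fun q => Tq q z)) z with hg
  have hlim : StronglyMeasurable fun z : ℝ × EuclideanSpace ℝ (Fin 3) => limUnder l (fun q => Tq q z) :=
    MeasureTheory.StronglyMeasurable.limUnder hTqm
  have hgm : StronglyMeasurable g := by
    refine StronglyMeasurable.indicator ?_ hEvm
    have h1 : Measurable fun z : ℝ × EuclideanSpace ℝ (Fin 3) => -‖U z.1 z.2‖ ^ 2 / 3 :=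
      ((hU.measurable.norm.pow_const 2).neg.div_const 3)
    exact (h1.add hlim.measurable).stronglyMeasurable
  refine ⟨g, hgm, fun t ht x => ?_⟩
  have hslice : AEStronglyMeasurable (U t) volume :=
    (hU.comp_measurable measurable_prodMk_left).aestronglyMeasurable
  have hiff := exists_hasPressurePV_iff_rat hslice (hint t ht) x
  by_cases hex : ∃ L, HasPressurePV (U t) x L
  · obtain ⟨L, hL⟩ := hex
    have hmem : (t, x) ∈ Ev := hiff.1 ⟨L, hL⟩
    have hconv : Tendsto (fun q => Tq q (t, x)) l (𝓝 L) := hL.2.comp tendsto_comap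
    rw [normalisedPressure_eq hL, finrank_euclideanSpace_fin, hg]
    dsimp only
    rw [indicator_of_mem hmem, hconv.limUnder_eq]
    push_cast
    ring
  · have hnmem : (t, x) ∉ Ev := fun h => hex (hiff.2 h)
    rw [normalisedPressure_eq_zero_of_not_exists hex, hg]
    dsimp only
    rw [indicator_of_notMem hnmem]

end SliceMeasurability

/-! ## §3. Joint measurability of the two terms of the expansion along a local Leray solution -/

section JointMeasurability

variable {T ν : ℝ} {v₀ : EuclideanSpace ℝ (Fin 3) → EuclideanSpace ℝ (Fin 3)}
  {v : ℝ → EuclideanSpace ℝ (Fin 3) → EuclideanSpace ℝ (Fin 3)}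
  {π : ℝ → EuclideanSpace ℝ (Fin 3) → ℝ}

/-- **The near field `π_loc(t, x) = p̃[1_{B_{2r}(x₀)} v(t)](x)` of a local Leray solution on a
slab is jointly a.e.-strongly measurable on `(0,T) × ℝ³`** (replace `v` by a strongly
measurable modification `ṽ`: the Riesz pressure of the slices of `1_{B_{2r}(x₀)} ṽ` has a
strongly measurable modification by `exists_stronglyMeasurable_normalisedPressure_eq`, and it
agrees with `π_loc` at every `(t, x)` with `v(t) = ṽ(t)` a.e. and `v(t,x) = ṽ(t,x)`, i.e. a.e.).
[folklore] -/
theorem IsLocalLeraySolutionOn.aestronglyMeasurable_localPressureNear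
    (hv : IsLocalLeraySolutionOn T ν v₀ v π) (x₀ : EuclideanSpace ℝ (Fin 3)) (r : ℝ) :
    AEStronglyMeasurable (fun z : ℝ × EuclideanSpace ℝ (Fin 3) => localPressureNear x₀ r v z.1 z.2)
      ((volume.restrict (Ioo (0 : ℝ) T)).prod (volume : Measure (EuclideanSpace ℝ (Fin 3)))) := by
  set μt : Measure ℝ := volume.restrict (Ioo (0 : ℝ) T) with hμt
  set S : Set (EuclideanSpace ℝ (Fin 3)) := ball x₀ (2 * r) with hS
  have hvm := hv.aestronglyMeasurable_prod
  set vt : ℝ × EuclideanSpace ℝ (Fin 3) → EuclideanSpace ℝ (Fin 3) := hvm.mk (uncurry v) with hvt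
  have hvtm : StronglyMeasurable vt := hvm.stronglyMeasurable_mk
  have hae : uncurry v =ᵐ[μt.prod volume] vt := hvm.ae_eq_mk
  -- the truncated modified field
  set U : ℝ → EuclideanSpace ℝ (Fin 3) → EuclideanSpace ℝ (Fin 3) := fun t y =>
    S.indicator (fun y => vt (t, y)) y with hU
  have hUm : StronglyMeasurable (uncurry U) := by
    have : uncurry U = (univ ×ˢ S).indicator vt := by
      funext z
      rcases z with ⟨t, y⟩
      rw [uncurry_apply_pair, hU]
      dsimp only
      by_cases hy : y ∈ S
      · rw [indicator_of_mem hy, indicator_of_mem (show (t, y) ∈ univ ×ˢ S from ⟨mem_univ _, hy⟩)]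
      · rw [indicator_of_notMem hy,
          indicator_of_notMem (show (t, y) ∉ univ ×ˢ S from fun h => hy h.2)]
    rw [this]
    exact hvtm.indicator (MeasurableSet.univ.prod measurableSet_ball)
  -- good times: `v t = vt (t, ·)` a.e. and `|v t|² ∈ L¹_loc`
  have hgood : ∀ᵐ t ∂μt, (v t =ᵐ[volume] fun y => vt (t, y)) ∧
      LocallyIntegrable (fun x => ‖v t x‖ ^ 2) volume := by
    filter_upwards [Measure.ae_ae_of_ae_prod hae, hv.ae_locallyIntegrable_norm_sq_slice] with t h1 h2
    exact ⟨h1, h2⟩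
  set G : Set ℝ := {t | (v t =ᵐ[volume] fun y => vt (t, y)) ∧
    LocallyIntegrable (fun x => ‖v t x‖ ^ 2) volume} with hG
  have hint : ∀ t ∈ G, Integrable (fun y => ‖U t y‖ ^ 2) volume := by
    intro t ht
    have h1 : IntegrableOn (fun y => ‖v t y‖ ^ 2) S volume :=
      (ht.2.integrableOn_isCompact (isCompact_closedBall x₀ (2 * r))).mono_set ball_subset_closedBall
    have h2 : IntegrableOn (fun y => ‖vt (t, y)‖ ^ 2) S volume := by
      refine h1.congr_fun_ae (ae_restrict_of_ae ?_)
      filter_upwards [ht.1] with y hy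
      rw [hy]
    have h3 := h2.integrable_indicator measurableSet_ball
    refine h3.congr (Eventually.of_forall fun y => ?_)
    simp only [hU]
    by_cases hy : y ∈ S
    · rw [indicator_of_mem hy, indicator_of_mem hy]
    · rw [indicator_of_notMem hy, indicator_of_notMem hy, norm_zero]
      ring
  obtain ⟨g, hgm, hg⟩ := exists_stronglyMeasurable_normalisedPressure_eq hUm hint
  -- `π_loc = g` a.e.
  refine ⟨g, hgm, ?_⟩
  have hG' : ∀ᵐ z : ℝ × EuclideanSpace ℝ (Fin 3) ∂μt.prod volume, z.1 ∈ G :=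
    (Measure.quasiMeasurePreserving_fst (μ := μt)
      (ν := (volume : Measure (EuclideanSpace ℝ (Fin 3))))).ae hgood
  filter_upwards [hG', hae] with z hz1 hz2
  rcases z with ⟨t, x⟩
  simp only [uncurry_apply_pair] at hz2
  dsimp only
  rw [localPressureNear_apply, ← hg t hz1 x]
  refine normalisedPressure_congr_ae ?_ ?_
  · filter_upwards [hz1.1] with y hy
    simp only [hU]
    by_cases hy' : y ∈ S
    · rw [indicator_of_mem hy', indicator_of_mem hy', hy]
    · rw [indicator_of_notMem hy', indicator_of_notMem hy']
  · simp only [hU]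
    by_cases hx : x ∈ S
    · rw [indicator_of_mem hx, indicator_of_mem hx, hz2]
    · rw [indicator_of_notMem hx, indicator_of_notMem hx]

/-- **The far field `π_far(t, x) = ∫_{|y-x₀|≥2r} (K(x-y) - K(x₀-y))(v(t,y)) dy` of a local
Leray solution on a slab is jointly a.e.-strongly measurable on `(0,T) × ℝ³`** (a parametric
integral of a measurable integrand after modification of `v` on a null set). [folklore] -/
theorem IsLocalLeraySolutionOn.aestronglyMeasurable_localPressureFar
    (hv : IsLocalLeraySolutionOn T ν v₀ v π) (x₀ : EuclideanSpace ℝ (Fin 3)) (r : ℝ) :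
    AEStronglyMeasurable (fun z : ℝ × EuclideanSpace ℝ (Fin 3) => localPressureFar x₀ r v z.1 z.2)
      ((volume.restrict (Ioo (0 : ℝ) T)).prod (volume : Measure (EuclideanSpace ℝ (Fin 3)))) := by
  set μt : Measure ℝ := volume.restrict (Ioo (0 : ℝ) T) with hμt
  set S : Set (EuclideanSpace ℝ (Fin 3)) := ball x₀ (2 * r) with hS
  have hvm := hv.aestronglyMeasurable_prod
  set vt : ℝ × EuclideanSpace ℝ (Fin 3) → EuclideanSpace ℝ (Fin 3) := hvm.mk (uncurry v) with hvt
  have hvtm : StronglyMeasurable vt := hvm.stronglyMeasurable_mk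
  have hae : uncurry v =ᵐ[μt.prod volume] vt := hvm.ae_eq_mk
  -- the modified far field is a parametric integral of a measurable integrand
  have hV : Measurable fun q : (ℝ × EuclideanSpace ℝ (Fin 3)) × EuclideanSpace ℝ (Fin 3) =>
      vt (q.1.1, q.2) :=
    hvtm.measurable.comp ((measurable_fst.comp measurable_fst).prodMk measurable_snd)
  have hK1 : Measurable ((fun p : EuclideanSpace ℝ (Fin 3) × EuclideanSpace ℝ (Fin 3) =>
      pressureKernel p.1 p.2) ∘ fun q : (ℝ × EuclideanSpace ℝ (Fin 3)) × EuclideanSpace ℝ (Fin 3) =>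
        (q.1.2 - q.2, vt (q.1.1, q.2))) :=
    measurable_pressureKernel.comp (((measurable_snd.comp measurable_fst).sub measurable_snd).prodMk hV)
  have hK2 : Measurable ((fun p : EuclideanSpace ℝ (Fin 3) × EuclideanSpace ℝ (Fin 3) =>
      pressureKernel p.1 p.2) ∘ fun q : (ℝ × EuclideanSpace ℝ (Fin 3)) × EuclideanSpace ℝ (Fin 3) =>
        (x₀ - q.2, vt (q.1.1, q.2))) :=
    measurable_pressureKernel.comp ((measurable_const.sub measurable_snd).prodMk hV)
  have hK : Measurable fun q : (ℝ × EuclideanSpace ℝ (Fin 3)) × EuclideanSpace ℝ (Fin 3) =>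
      pressureKernel (q.1.2 - q.2) (vt (q.1.1, q.2)) - pressureKernel (x₀ - q.2) (vt (q.1.1, q.2)) := by
    have h := hK1.sub hK2
    exact h
  have hD : MeasurableSet {q : (ℝ × EuclideanSpace ℝ (Fin 3)) × EuclideanSpace ℝ (Fin 3) | q.2 ∉ S} :=
    (measurableSet_ball.preimage measurable_snd).compl
  set F : (ℝ × EuclideanSpace ℝ (Fin 3)) × EuclideanSpace ℝ (Fin 3) → ℝ :=
    {q : (ℝ × EuclideanSpace ℝ (Fin 3)) × EuclideanSpace ℝ (Fin 3) | q.2 ∉ S}.indicator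
      fun q => pressureKernel (q.1.2 - q.2) (vt (q.1.1, q.2)) -
        pressureKernel (x₀ - q.2) (vt (q.1.1, q.2)) with hF
  have hFm : Measurable F := hK.indicator hD
  have h1 : StronglyMeasurable fun z : ℝ × EuclideanSpace ℝ (Fin 3) => ∫ y, F (z, y) :=
    hFm.stronglyMeasurable.integral_prod_right'
  refine ⟨fun z => ∫ y, F (z, y), h1, ?_⟩
  have hsl : ∀ᵐ z : ℝ × EuclideanSpace ℝ (Fin 3) ∂μt.prod volume,
      v z.1 =ᵐ[volume] fun y => vt (z.1, y) :=
    (Measure.quasiMeasurePreserving_fst (μ := μt)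
      (ν := (volume : Measure (EuclideanSpace ℝ (Fin 3))))).ae (Measure.ae_ae_of_ae_prod hae)
  filter_upwards [hsl] with z hz
  rcases z with ⟨t, x⟩
  dsimp only
  rw [localPressureFar_apply, ← integral_indicator measurableSet_ball.compl]
  refine integral_congr_ae ?_
  filter_upwards [hz] with y hy
  by_cases hyS : y ∈ S
  · have h2 : ((t, x), y) ∉ {q : (ℝ × EuclideanSpace ℝ (Fin 3)) × EuclideanSpace ℝ (Fin 3) |
        q.2 ∉ S} := fun h => h hyS
    rw [indicator_of_notMem (notMem_compl_iff.2 hyS), hF, indicator_of_notMem h2]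
  · have h2 : ((t, x), y) ∈ {q : (ℝ × EuclideanSpace ℝ (Fin 3)) × EuclideanSpace ℝ (Fin 3) |
        q.2 ∉ S} := hyS
    rw [indicator_of_mem (mem_compl hyS), hF, indicator_of_mem h2]
    show _ = pressureKernel (x - y) (vt (t, y)) - pressureKernel (x₀ - y) (vt (t, y))
    rw [hy]

end JointMeasurability

/-! ## §4. The expansion on almost every time slice of a local Leray solution -/

section Slices

variable {ν : ℝ} {v₀ : EuclideanSpace ℝ (Fin 3) → EuclideanSpace ℝ (Fin 3)}
  {v : ℝ → EuclideanSpace ℝ (Fin 3) → EuclideanSpace ℝ (Fin 3)}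
  {π : ℝ → EuclideanSpace ℝ (Fin 3) → ℝ}

/-- For a.e. `t ∈ (0,T)`, the slice `v(t)` is in `L³` of every ball `B_ρ(x₀)` (Tonelli on
`(0,T) × B̄_ρ(x₀)`, where `v ∈ L³` up to `t = 0`). [folklore] -/
theorem IsLocalLeraySolution.ae_lintegral_cube_ball_lt_top (hv : IsLocalLeraySolution ν v₀ v π)
    {T : ℝ} (hT : 0 < T) (x₀ : EuclideanSpace ℝ (Fin 3)) (ρ : ℝ) :
    ∀ᵐ t ∂(volume.restrict (Ioo (0 : ℝ) T)), ∫⁻ y in ball x₀ ρ, ‖v t y‖ₑ ^ (3 : ℕ) < ⊤ := by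
  set μt : Measure ℝ := volume.restrict (Ioo (0 : ℝ) T) with hμt
  set K : Set (EuclideanSpace ℝ (Fin 3)) := closedBall x₀ ρ with hK
  set μK : Measure (EuclideanSpace ℝ (Fin 3)) := volume.restrict K with hμK
  have hprod : μt.prod μK = volume.restrict (Ioo (0 : ℝ) T ×ˢ K) := by
    rw [hμt, hμK, Measure.prod_restrict, ← Measure.volume_eq_prod]
  have hvmK : AEStronglyMeasurable (uncurry v) (μt.prod μK) := hv.aestronglyMeasurable_box T K
  have hG : AEMeasurable (fun z : ℝ × EuclideanSpace ℝ (Fin 3) => ‖v z.1 z.2‖ₑ ^ (3 : ℕ)) (μt.prod μK) :=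
    hvmK.enorm.pow_const _
  have hfin : ∫⁻ t, ∫⁻ x, ‖v t x‖ₑ ^ (3 : ℕ) ∂μK ∂μt < ⊤ := by
    rw [← lintegral_prod _ hG, hprod]
    exact hv.lintegral_cube_block_lt_top hT (isCompact_closedBall _ _)
  have hslice : ∀ᵐ t ∂μt, ∫⁻ x, ‖v t x‖ₑ ^ (3 : ℕ) ∂μK < ⊤ :=
    ae_lt_top' hG.lintegral_prod_right' hfin.ne
  filter_upwards [hslice] with t ht
  exact lt_of_le_of_lt (lintegral_mono_set ball_subset_closedBall) ht

/-- **The local pressure expansion on almost every time slice** (Kang–Miura–Tsai 2021,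
Lemma 3.4, slice by slice): for a local Leray solution `(v, π)` (Def. 3.2), `T > 0`, a centre
`x₀` and a radius `r > 0`, for a.e. `t ∈ (0,T)` there is a constant `κ(t)` with
`π(t) = π_loc(t) + π_far(t) + κ(t)` a.e. on `B_r(x₀)` (the Liouville identities on a.e. slice,
`IsLocalLeraySolutionOn.ae_slice_pgIdentity`, fed into `slice_pressure_representation`).
[cite: KangMiuraTsai2020, Lemma 3.4 (pressure decomposition), arXiv:1812.10509 p. 8] -/
theorem IsLocalLeraySolution.ae_exists_slice_representation (hv : IsLocalLeraySolution ν v₀ v π)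
    {T : ℝ} (hT : 0 < T) (x₀ : EuclideanSpace ℝ (Fin 3)) {r : ℝ} (hr : 0 < r) :
    ∀ᵐ t ∂(volume.restrict (Ioo (0 : ℝ) T)), ∃ κ : ℝ,
      ∀ᵐ x ∂(volume.restrict (ball x₀ r)),
        π t x = localPressureNear x₀ r v t x + localPressureFar x₀ r v t x + κ := by
  obtain ⟨A, hA⟩ := (hv.isLocalLeraySolutionOn T).ae_slice_pgIdentity
  filter_upwards [hA, hv.ae_lintegral_cube_ball_lt_top hT x₀ (2 * r)] with t ht hct
  obtain ⟨hmt, -, hπt, hAt, -, hid⟩ := ht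
  obtain ⟨κ, -, hrep⟩ := slice_pressure_representation (A := (A : ℝ≥0∞)) hmt ENNReal.coe_ne_top
    hAt hπt hid x₀ hr hct.ne
  exact ⟨κ, hrep⟩

end Slices

/-! ## §5. The gauge -/

section Gauge

variable {ν : ℝ} {v₀ : EuclideanSpace ℝ (Fin 3) → EuclideanSpace ℝ (Fin 3)}
  {v : ℝ → EuclideanSpace ℝ (Fin 3) → EuclideanSpace ℝ (Fin 3)}
  {π : ℝ → EuclideanSpace ℝ (Fin 3) → ℝ}

/-- `(a + b + c)^{3/2} ≤ 2 (a^{3/2} + b^{3/2} + c^{3/2})` in `ℝ≥0∞`. [folklore] -/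
theorem add_add_rpow_threeHalves_le (a b c : ℝ≥0∞) :
    (a + b + c) ^ (3 / 2 : ℝ) ≤ 2 * (a ^ (3 / 2 : ℝ) + b ^ (3 / 2 : ℝ) + c ^ (3 / 2 : ℝ)) := by
  have hs : (2 : ℝ≥0∞) ^ (1 / 2 : ℝ) ≤ 2 := by
    calc (2 : ℝ≥0∞) ^ (1 / 2 : ℝ) ≤ (2 : ℝ≥0∞) ^ (1 : ℝ) :=
          ENNReal.rpow_le_rpow_of_exponent_le (by norm_num) (by norm_num)
      _ = 2 := ENNReal.rpow_one _
  have hss : (2 : ℝ≥0∞) ^ (1 / 2 : ℝ) * (2 : ℝ≥0∞) ^ (1 / 2 : ℝ) = 2 := by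
    rw [← ENNReal.rpow_add _ _ (by norm_num) (by norm_num)]
    norm_num
  calc (a + b + c) ^ (3 / 2 : ℝ)
      ≤ (2 : ℝ≥0∞) ^ (1 / 2 : ℝ) * ((a + b) ^ (3 / 2 : ℝ) + c ^ (3 / 2 : ℝ)) :=
        add_rpow_threeHalves_le _ _
    _ ≤ (2 : ℝ≥0∞) ^ (1 / 2 : ℝ) *
        ((2 : ℝ≥0∞) ^ (1 / 2 : ℝ) * (a ^ (3 / 2 : ℝ) + b ^ (3 / 2 : ℝ)) + c ^ (3 / 2 : ℝ)) := by
        gcongr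
        exact add_rpow_threeHalves_le _ _
    _ = 2 * (a ^ (3 / 2 : ℝ) + b ^ (3 / 2 : ℝ)) + (2 : ℝ≥0∞) ^ (1 / 2 : ℝ) * c ^ (3 / 2 : ℝ) := by
        rw [mul_add, ← mul_assoc, hss]
    _ ≤ 2 * (a ^ (3 / 2 : ℝ) + b ^ (3 / 2 : ℝ)) + 2 * c ^ (3 / 2 : ℝ) := by
        gcongr
    _ = 2 * (a ^ (3 / 2 : ℝ) + b ^ (3 / 2 : ℝ) + c ^ (3 / 2 : ℝ)) := by ring

/-- The far-field weight `|z|⁻⁴` as `RieszKernel.powKer 4`. [folklore] -/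
theorem powKer_four_eq_ofReal_inv (z : EuclideanSpace ℝ (Fin 3)) :
    RieszKernel.powKer 4 z = ENNReal.ofReal ((‖z‖ ^ 4)⁻¹) := by
  rw [RieszKernel.powKer_apply, inv_norm_pow_four_eq_rpow]

/-- **The gauge of the local pressure expansion and its integrability** (Kang–Miura–Tsai 2021,
Lemma 3.4: "for some function `c_{x₀,r}(t) ∈ L^{3/2}(0,T)`"). For a local Leray solution,
`T > 0`, `x₀`, `r > 0`, the ball mean `c(t) = ⨍_{B_r(x₀)} (π - π_loc - π_far)(t, x) dx` is in
`L^{3/2}(0,T)` and `π(t) = π_loc(t) + π_far(t) + c(t)` a.e. on `B_r(x₀)` for a.e. `t ∈ (0,T)`: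
measurability by Fubini (the three terms are jointly measurable), the identity by §4 (the
integrand is a.e. the constant `κ(t)`), and the bound
`|c(t)|^{3/2} |B_r| ≤ 2(∫_{B_r}|π(t)|^{3/2} + C ∫_{B_{2r}}|v(t)|³ + |B_r| (C_K r · tail(t))^{3/2})`
by Calderón–Zygmund for the near field (`exists_lintegral_localPressureNear_le` with the proved
`stein1970_normalisedPressure_ae_Lp_bound_holds`) and the kernel bound for the far field
(`enorm_localPressureFar_le`, `exists_farField_tail_le`), integrated in time with
`π ∈ L^{3/2}`, `v ∈ L³` on the boxes up to `t = 0`.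
[cite: KangMiuraTsai2020, Lemma 3.4 (the gauge c_{x₀,r} ∈ L^{3/2}(0,T)) with §8 (bounds for p_loc, p_far), arXiv:1812.10509 pp. 8, 18] -/
theorem IsLocalLeraySolution.exists_gauge (hv : IsLocalLeraySolution ν v₀ v π)
    {T : ℝ} (hT : 0 < T) (x₀ : EuclideanSpace ℝ (Fin 3)) {r : ℝ} (hr : 0 < r) :
    ∃ c : ℝ → ℝ, MemLp c (3 / 2 : ℝ≥0∞) (volume.restrict (Ioo 0 T)) ∧
      ∀ᵐ t ∂(volume.restrict (Ioo (0 : ℝ) T)), ∀ᵐ x ∂(volume.restrict (ball x₀ r)),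
        π t x = localPressureNear x₀ r v t x + localPressureFar x₀ r v t x + c t := by
  set B : Set (EuclideanSpace ℝ (Fin 3)) := ball x₀ r with hB
  set S : Set (EuclideanSpace ℝ (Fin 3)) := ball x₀ (2 * r) with hS
  set μt : Measure ℝ := volume.restrict (Ioo (0 : ℝ) T) with hμt
  set μB : Measure (EuclideanSpace ℝ (Fin 3)) := volume.restrict B with hμB
  set N := localPressureNear x₀ r v with hN
  set Fa := localPressureFar x₀ r v with hFa
  have hvT := hv.isLocalLeraySolutionOn T
  have hB0 : volume B ≠ 0 := (measure_ball_pos volume x₀ hr).ne'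
  have hBt : volume B ≠ ⊤ := measure_ball_lt_top.ne
  -- joint measurability on `(0,T) × B`
  have hπm : AEStronglyMeasurable (uncurry π) (μt.prod μB) := hv.aestronglyMeasurable_pressure_box T B
  have hNm : AEStronglyMeasurable (fun z : ℝ × EuclideanSpace ℝ (Fin 3) => N z.1 z.2) (μt.prod μB) :=
    (hvT.aestronglyMeasurable_localPressureNear x₀ r).mono_measure
      (Measure.prod_mono le_rfl Measure.restrict_le_self)
  have hFam : AEStronglyMeasurable (fun z : ℝ × EuclideanSpace ℝ (Fin 3) => Fa z.1 z.2) (μt.prod μB) :=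
    (hvT.aestronglyMeasurable_localPressureFar x₀ r).mono_measure
      (Measure.prod_mono le_rfl Measure.restrict_le_self)
  set D : ℝ → EuclideanSpace ℝ (Fin 3) → ℝ := fun t x => π t x - N t x - Fa t x with hD
  have hDm : AEStronglyMeasurable (uncurry D) (μt.prod μB) := (hπm.sub hNm).sub hFam
  -- the gauge
  set c : ℝ → ℝ := fun t => ⨍ x in B, D t x with hc
  have hcm : AEStronglyMeasurable c μt := by
    have h1 : AEStronglyMeasurable (fun t => ∫ x in B, D t x) μt := hDm.integral_prod_right'
    have h2 : c = fun t => ((volume : Measure (EuclideanSpace ℝ (Fin 3))).real B)⁻¹ • ∫ x in B, D t x := by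
      funext t
      rw [hc]
      exact setAverage_eq _ _ _
    rw [h2]
    exact h1.const_smul (((volume : Measure (EuclideanSpace ℝ (Fin 3))).real B)⁻¹)
  -- the identity on a.e. slice, and `c t = κ t`
  have hslice : ∀ᵐ t ∂μt, ∀ᵐ x ∂μB, π t x = N t x + Fa t x + c t := by
    filter_upwards [hv.ae_exists_slice_representation hT x₀ hr] with t ht
    obtain ⟨κ, hκ⟩ := ht
    have hDκ : (fun x => D t x) =ᵐ[μB] fun _ => κ := by
      filter_upwards [hκ] with x hx
      simp only [hD, hx]
      ring
    have hct : c t = κ := by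
      show ⨍ x, D t x ∂μB = κ
      rw [average_congr hDκ, hμB]
      exact setAverage_const hB0 hBt _
    filter_upwards [hκ] with x hx
    rw [hct, hx]
  refine ⟨c, ⟨hcm, ?_⟩, hslice⟩
  -- ## the `L^{3/2}` bound on the gauge
  obtain ⟨Cn, hCn0, hCntop, hnear⟩ :=
    exists_lintegral_localPressureNear_le stein1970_normalisedPressure_ae_Lp_bound_holds
  obtain ⟨CK, hCK0, hCK⟩ := exists_abs_pressureKernel_sub_le
  obtain ⟨Kf, hKftop, hKf⟩ := exists_farField_tail_le hr
  obtain ⟨Ar, hAr⟩ := hv.exists_ae_lintegral_ball_le T r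
  -- the far-field tail is uniformly bounded for a.e. `t`
  set TB : ℝ≥0∞ := Kf * ENNReal.ofReal ((2 * r - r)⁻¹) * Ar with hTB
  have hTBtop : TB ≠ ⊤ :=
    ENNReal.mul_ne_top (ENNReal.mul_ne_top hKftop ENNReal.ofReal_ne_top) ENNReal.coe_ne_top
  have hTail_le : ∀ᵐ t ∂μt,
      ∫⁻ y in Sᶜ, ‖v t y‖ₑ ^ (2 : ℕ) * RieszKernel.powKer 4 (y - x₀) ≤ TB := by
    filter_upwards [hAr, hvT.ae_aestronglyMeasurable_slice'] with t hAt hmt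
    have h := hKf (fun y => ‖v t y‖ₑ ^ (2 : ℕ)) (hmt.enorm.pow_const _) Ar hAt x₀ (2 * r) le_rfl
    simp_rw [powKer_four_eq_ofReal_inv]
    exact h
  set FB : ℝ≥0∞ := ENNReal.ofReal (CK * r) * TB with hFB
  have hFBtop : FB ≠ ⊤ := ENNReal.mul_ne_top ENNReal.ofReal_ne_top hTBtop
  -- slice measurability of the pressure
  have hπslice : ∀ᵐ t ∂μt, AEStronglyMeasurable (π t) μB := by
    filter_upwards [hπm.prodMk_left] with t ht
    exact ht
  -- abbreviations for the slice functionals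
  set P : ℝ → ℝ≥0∞ := fun t => ∫⁻ x in B, ‖π t x‖ₑ ^ (3 / 2 : ℝ) with hP
  set V3 : ℝ → ℝ≥0∞ := fun t => ∫⁻ y in S, ‖v t y‖ₑ ^ (3 : ℕ) with hV3
  -- the bound on a.e. slice
  have hpt : ∀ᵐ t ∂μt, ‖c t‖ₑ ^ (3 / 2 : ℝ) ≤
      (volume B)⁻¹ * (2 * (P t + Cn * V3 t)) + 2 * FB ^ (3 / 2 : ℝ) := by
    filter_upwards [hslice, hTail_le, hπslice, hvT.ae_aestronglyMeasurable_slice',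
      hv.ae_lintegral_cube_ball_lt_top hT x₀ (2 * r)] with t hid hTt hπt hvt hct
    -- `‖c t‖^{3/2} |B| = ∫_B |π - N - Fa|^{3/2}`
    have h1 : ‖c t‖ₑ ^ (3 / 2 : ℝ) * volume B =
        ∫⁻ x in B, ‖π t x - N t x - Fa t x‖ₑ ^ (3 / 2 : ℝ) := by
      rw [← setLIntegral_const]
      refine lintegral_congr_ae ?_
      filter_upwards [hid] with x hx
      rw [hx]
      congr 2
      ring
    -- pointwise bound on `B`
    have hfar : ∀ x ∈ B, ‖Fa t x‖ₑ ≤ FB := fun x hx =>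
      (enorm_localPressureFar_le hCK0 hCK x₀ hr v t hx).trans (mul_le_mul' le_rfl hTt)
    have h2 : ∀ x ∈ B, ‖π t x - N t x - Fa t x‖ₑ ^ (3 / 2 : ℝ) ≤
        2 * (‖π t x‖ₑ ^ (3 / 2 : ℝ) + ‖N t x‖ₑ ^ (3 / 2 : ℝ) + FB ^ (3 / 2 : ℝ)) := by
      intro x hx
      calc ‖π t x - N t x - Fa t x‖ₑ ^ (3 / 2 : ℝ)
          ≤ (‖π t x‖ₑ + ‖N t x‖ₑ + ‖Fa t x‖ₑ) ^ (3 / 2 : ℝ) := by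
            refine ENNReal.rpow_le_rpow ?_ (by norm_num)
            calc ‖π t x - N t x - Fa t x‖ₑ ≤ ‖π t x - N t x‖ₑ + ‖Fa t x‖ₑ := enorm_sub_le
              _ ≤ ‖π t x‖ₑ + ‖N t x‖ₑ + ‖Fa t x‖ₑ := add_le_add enorm_sub_le le_rfl
        _ ≤ 2 * (‖π t x‖ₑ ^ (3 / 2 : ℝ) + ‖N t x‖ₑ ^ (3 / 2 : ℝ) + ‖Fa t x‖ₑ ^ (3 / 2 : ℝ)) :=
            add_add_rpow_threeHalves_le _ _ _
        _ ≤ 2 * (‖π t x‖ₑ ^ (3 / 2 : ℝ) + ‖N t x‖ₑ ^ (3 / 2 : ℝ) + FB ^ (3 / 2 : ℝ)) := by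
            gcongr
            exact hfar x hx
    -- integrate over `B`
    have hNB : ∫⁻ x in B, ‖N t x‖ₑ ^ (3 / 2 : ℝ) ≤ Cn * V3 t :=
      (lintegral_mono' Measure.restrict_le_self le_rfl).trans (hnear x₀ r v t hvt hct.ne)
    have h3 : ∫⁻ x in B, ‖π t x - N t x - Fa t x‖ₑ ^ (3 / 2 : ℝ) ≤
        2 * (P t + Cn * V3 t) + 2 * FB ^ (3 / 2 : ℝ) * volume B := by
      calc ∫⁻ x in B, ‖π t x - N t x - Fa t x‖ₑ ^ (3 / 2 : ℝ)
          ≤ ∫⁻ x in B, 2 * (‖π t x‖ₑ ^ (3 / 2 : ℝ) + ‖N t x‖ₑ ^ (3 / 2 : ℝ) + FB ^ (3 / 2 : ℝ)) :=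
            setLIntegral_mono' measurableSet_ball h2
        _ = 2 * (P t + (∫⁻ x in B, ‖N t x‖ₑ ^ (3 / 2 : ℝ)) + FB ^ (3 / 2 : ℝ) * volume B) := by
            rw [lintegral_const_mul' _ _ ENNReal.ofNat_ne_top, lintegral_add_right' _ aemeasurable_const,
              lintegral_add_left' (hπt.enorm.pow_const _), setLIntegral_const]
        _ ≤ 2 * (P t + Cn * V3 t + FB ^ (3 / 2 : ℝ) * volume B) := by gcongr
        _ = 2 * (P t + Cn * V3 t) + 2 * FB ^ (3 / 2 : ℝ) * volume B := by ring
    -- divide by `|B|`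
    have h4 : ‖c t‖ₑ ^ (3 / 2 : ℝ) * volume B ≤ 2 * (P t + Cn * V3 t) + 2 * FB ^ (3 / 2 : ℝ) * volume B := by
      rw [h1]; exact h3
    calc ‖c t‖ₑ ^ (3 / 2 : ℝ) = ‖c t‖ₑ ^ (3 / 2 : ℝ) * volume B / volume B := by
          rw [ENNReal.mul_div_cancel_right hB0 hBt]
      _ ≤ (2 * (P t + Cn * V3 t) + 2 * FB ^ (3 / 2 : ℝ) * volume B) / volume B :=
          ENNReal.div_le_div_right h4 _
      _ = (volume B)⁻¹ * (2 * (P t + Cn * V3 t)) + 2 * FB ^ (3 / 2 : ℝ) := by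
          rw [ENNReal.add_div, ENNReal.mul_div_cancel_right hB0 hBt, div_eq_mul_inv, mul_comm]
  -- integrate in time
  have hvS : AEStronglyMeasurable (uncurry v) (μt.prod (volume.restrict S)) :=
    hv.aestronglyMeasurable_box T S
  have hPm : AEMeasurable P μt := (hπm.enorm.pow_const _).lintegral_prod_right'
  have hV3m : AEMeasurable V3 μt := (hvS.enorm.pow_const _).lintegral_prod_right'
  have hPfin : ∫⁻ t, P t ∂μt ≠ ⊤ := by
    rw [hP, hμt, lintegral_lintegral_enorm_rpow_box hπm (3 / 2)]
    refine (lt_of_le_of_lt (lintegral_mono_set (Set.prod_mono Subset.rfl ball_subset_closedBall))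
      (hv.pressure T hT (closedBall x₀ r) (isCompact_closedBall _ _))).ne
  have hV3fin : ∫⁻ t, V3 t ∂μt ≠ ⊤ := by
    rw [hV3, hμt, lintegral_lintegral_enorm_pow_box hvS 3]
    refine (lt_of_le_of_lt (lintegral_mono_set (Set.prod_mono Subset.rfl ball_subset_closedBall))
      (hv.lintegral_cube_block_lt_top hT (isCompact_closedBall x₀ (2 * r)))).ne
  have hXm : AEMeasurable (fun t => (volume B)⁻¹ * (2 * (P t + Cn * V3 t))) μt :=
    ((hPm.add (hV3m.const_mul _)).const_mul _).const_mul _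
  have hX : ∫⁻ t, (volume B)⁻¹ * (2 * (P t + Cn * V3 t)) ∂μt =
      (volume B)⁻¹ * (2 * ((∫⁻ t, P t ∂μt) + Cn * ∫⁻ t, V3 t ∂μt)) := by
    rw [lintegral_const_mul' _ _ (ENNReal.inv_ne_top.2 hB0), lintegral_const_mul' _ _ ENNReal.ofNat_ne_top,
      lintegral_add_left' hPm, lintegral_const_mul' _ _ hCntop]
  have hXfin : ∫⁻ t, (volume B)⁻¹ * (2 * (P t + Cn * V3 t)) ∂μt ≠ ⊤ := by
    rw [hX]
    exact ENNReal.mul_ne_top (ENNReal.inv_ne_top.2 hB0) (ENNReal.mul_ne_top ENNReal.ofNat_ne_top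
      (ENNReal.add_ne_top.2 ⟨hPfin, ENNReal.mul_ne_top hCntop hV3fin⟩))
  have hμt_fin : μt univ ≠ ⊤ := by
    rw [hμt, Measure.restrict_apply_univ]
    exact measure_Ioo_lt_top.ne
  have hfin : ∫⁻ t, ‖c t‖ₑ ^ (3 / 2 : ℝ) ∂μt ≠ ⊤ := by
    refine ne_top_of_le_ne_top ?_ (lintegral_mono_ae hpt)
    rw [lintegral_add_right' _ aemeasurable_const, lintegral_const]
    exact ENNReal.add_ne_top.2 ⟨hXfin, ENNReal.mul_ne_top (ENNReal.mul_ne_top ENNReal.ofNat_ne_top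
      (ENNReal.rpow_ne_top_of_nonneg (by norm_num) hFBtop)) hμt_fin⟩
  exact eLpNorm_threeHalves_lt_top_of_lintegral hfin

end Gauge

/-! ## §6. The discharge -/

/-- **The local pressure decomposition of local Leray solutions holds**
(`kangMiuraTsai_pressure_decomposition`, **PD**; Kang–Miura–Tsai, IMRN 2021 = arXiv:1812.10509,
**Lemma 3.4**: for a local Leray solution `(v, π)` in the sense of Def. 3.2, every `x₀`,
`r > 0`, `T > 0`, `π = π_loc + π_far + c_{x₀,r}(t)` on `B_r(x₀) × (0,T)` with
`c_{x₀,r} ∈ L^{3/2}(0,T)`). *Proof.* On a.e. time slice the expansion holds with some constant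
(`IsLocalLeraySolution.ae_exists_slice_representation`: the Liouville step of
Fernández-Dalgo–Lemarié-Rieusset on the slab, `IsLocalLeraySolutionOn.ae_slice_pgIdentity`, the
convergence of the mollified pressures at Lebesgue points and of the regularised near field to
the Riesz-transform pressure, `slice_pressure_representation`); the ball mean of
`π - π_loc - π_far` is then a gauge in `L^{3/2}(0,T)` (`IsLocalLeraySolution.exists_gauge`), and
the slice-wise identity is an identity a.e. on `(0,T) × B_r(x₀)` because all terms are jointly
measurable (`IsLocalLeraySolutionOn.aestronglyMeasurable_localPressureNear`, `…Far`). The datum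
hypotheses (`v₀ ∈ E²`, weakly divergence free) and `ν = 1` are not used.
[cite: KangMiuraTsai2020, Lemma 3.4 (pressure decomposition), arXiv:1812.10509 p. 8; proof §8 pp. 17–18] -/
theorem kangMiuraTsai_pressure_decomposition_holds : kangMiuraTsai_pressure_decomposition := by
  intro v₀ _hE2 _hdiv v π hv x₀ r T hr hT
  set B : Set (EuclideanSpace ℝ (Fin 3)) := ball x₀ r with hB
  set μt : Measure ℝ := volume.restrict (Ioo (0 : ℝ) T) with hμt
  set μB : Measure (EuclideanSpace ℝ (Fin 3)) := volume.restrict B with hμB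
  have hprod : μt.prod μB = volume.restrict (Ioo (0 : ℝ) T ×ˢ B) := by
    rw [hμt, hμB, Measure.prod_restrict, ← Measure.volume_eq_prod]
  obtain ⟨c, hc, hslice⟩ := hv.exists_gauge hT x₀ hr
  refine ⟨c, hc, ?_⟩
  have hvT := hv.isLocalLeraySolutionOn T
  -- joint measurability of all terms on `(0,T) × B`
  have hπm : AEStronglyMeasurable (uncurry π) (μt.prod μB) := hv.aestronglyMeasurable_pressure_box T B
  have hNm : AEStronglyMeasurable
      (fun z : ℝ × EuclideanSpace ℝ (Fin 3) => localPressureNear x₀ r v z.1 z.2) (μt.prod μB) :=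
    (hvT.aestronglyMeasurable_localPressureNear x₀ r).mono_measure
      (Measure.prod_mono le_rfl Measure.restrict_le_self)
  have hFam : AEStronglyMeasurable
      (fun z : ℝ × EuclideanSpace ℝ (Fin 3) => localPressureFar x₀ r v z.1 z.2) (μt.prod μB) :=
    (hvT.aestronglyMeasurable_localPressureFar x₀ r).mono_measure
      (Measure.prod_mono le_rfl Measure.restrict_le_self)
  have hcm : AEStronglyMeasurable (fun z : ℝ × EuclideanSpace ℝ (Fin 3) => c z.1) (μt.prod μB) :=
    hc.1.comp_fst
  set Φ : ℝ × EuclideanSpace ℝ (Fin 3) → ℝ := fun z =>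
    π z.1 z.2 - (localPressureNear x₀ r v z.1 z.2 + localPressureFar x₀ r v z.1 z.2 + c z.1) with hΦ
  have hΦm : AEStronglyMeasurable Φ (μt.prod μB) := hπm.sub ((hNm.add hFam).add hcm)
  -- the measurable modification and its zero set
  have hE : MeasurableSet {z | hΦm.mk Φ z = 0} :=
    hΦm.stronglyMeasurable_mk.measurable (measurableSet_singleton 0)
  have h1 : Φ =ᵐ[μt.prod μB] hΦm.mk Φ := hΦm.ae_eq_mk
  have h2 : ∀ᵐ t ∂μt, ∀ᵐ x ∂μB, Φ (t, x) = hΦm.mk Φ (t, x) := Measure.ae_ae_of_ae_prod h1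
  have h3 : ∀ᵐ t ∂μt, ∀ᵐ x ∂μB, (t, x) ∈ {z | hΦm.mk Φ z = 0} := by
    filter_upwards [h2, hslice] with t ht hs
    filter_upwards [ht, hs] with x hx hsx
    show hΦm.mk Φ (t, x) = 0
    rw [← hx, hΦ]
    dsimp only
    rw [hsx]
    ring
  have h4 : ∀ᵐ z ∂μt.prod μB, z ∈ {z | hΦm.mk Φ z = 0} :=
    (Measure.ae_prod_mem_iff_ae_ae_mem hE).2 h3
  rw [← hprod]
  filter_upwards [h4, h1] with z hz hz1
  have hΦz : Φ z = 0 := by rw [hz1]; exact hz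
  rw [hΦ] at hΦz
  dsimp only at hΦz
  linarith

end Literature.Analysis.FluidPDE
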